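import Summits.SmoothPoincare4.SmoothPoincare4.Theorems.ConvexBisectionAcyclicBisectionExistsPageRotationFlow
import Summits.SmoothPoincare4.SmoothPoincare4.Theorems.ConvexBisectionAcyclicBisectionExistsPageInvariance
import Literature.Topology.FourManifolds.ClosedBallProofs
import Literature.GroupTheory.CombinatorialGroupTheory.SignedHurwitzStabilisation
import HarnessLib

/-!
# Node N3a `node_STcurve` on an arbitrary page from the page of direction `1`, by the rigid
# page rotation (wave 6, brick G6-4 of stub `stub_STgeo` = NF4 N3, line `modp-braid-orbits`,
# crux `ConvexBisection.AcyclicBisectionExists`, item stmt-SmoothPoincare4-10508; registered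
# sub-goal `helper_STcurve_of_page_one`)

If every primitive class is the shadow of a smoothly embedded curve in the page `page g 1`, then
the same holds in every flat open page `page g d`, `‖d‖ = 1` (`stcurve_of_page_one`, registered
`helper_STcurve_of_page_one`): transport the curve by the stage `t = 1` of the rigid page-rotation
isotopy `R` of `Base g` with constant angular speed `arg d` (`helper_rotFlow_page`,
`…PageRotationFlow.lean`: `R_1 (page g 1) ⊆ page g (e^{i arg d}) = page g d`), which is a
diffeomorphism (`AmbientIsotopy.toDiffeomorph`, so embeddings go to embeddings,
`Manifold.IsSmoothEmbedding.diffeomorph_comp`) isotopic to the identity (so shadows are kept,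
`shadow_comp_ambientIsotopy`, `…PageInvariance.lean`).  With `…StabilisationCurves.lean`
(`helper_STcurve_of_twists`) this reduces N3a to page Dehn twist packages and one embedded base
curve ON THE PAGE OF DIRECTION `1`, where the product charts of the twist construction do not
leave the flat region `‖x‖ < 2` (report G6 §3).  Everything is proved; no definitions, no named
facts, no `sorry`.  Reference: R. İ. Baykur, *Kähler decomposition of 4-manifolds* (2006), proof
of Thm. 5.1 [Baykur2006]. [folklore]
-/

noncomputable section

set_option linter.dupNamespace false

open scoped Manifold ContDiff Topology
open Set Function
open Literature.Topology.FourManifolds Literature.Topology.FourManifolds.LefschetzBase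
  Literature.GroupTheory.CombinatorialGroupTheory.SignedHurwitz

namespace Summit.SmoothPoincare4.SmoothPoincare4.Theorems.AcyclicBisectionExists.ModpBraidOrbits

/-- **A rigid page rotation carries `page g 1` onto `page g d`** keeping shadows and embeddedness:
every smoothly embedded curve of `page g 1` is moved to a smoothly embedded curve of `page g d`
with the same shadow. [cite: Baykur2006, proof of Thm. 5.1] -/
theorem exists_embedded_pageCurve_rotate (g : ℕ) {d : ℂ} (hd : ‖d‖ = 1)
    (K : Metric.sphere (0 : EuclideanSpace ℝ (Fin 2)) 1 → Base g)
    (hKe : Manifold.IsSmoothEmbedding (𝓡 1) (𝓡∂ 4) ∞ K) (hKp : ∀ θ, K θ ∈ page g 1) (hK : Continuous K) :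
    ∃ K' : Metric.sphere (0 : EuclideanSpace ℝ (Fin 2)) 1 → Base g,
      Manifold.IsSmoothEmbedding (𝓡 1) (𝓡∂ 4) ∞ K' ∧ (∀ θ, K' θ ∈ page g d) ∧
      ∃ hK' : Continuous K', shadow g K' hK' = shadow g K hK := by
  obtain ⟨R, θ, -, -, -, -, -, -, -, -, hrot⟩ := helper_rotFlow_page g (fun _ => Complex.arg d) contDiff_const
  have hpage : ∀ x, x ∈ page g 1 → R.toFun 1 x ∈ page g d := fun x hx => by
    have h := hrot (Complex.arg d) (fun _ => rfl) x 1 1 hx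
    have hd' : Complex.exp (Complex.I * (Complex.arg d : ℝ) * (1 : ℝ)) * 1 = d := by
      rw [Complex.ofReal_one, mul_one, mul_one, mul_comm]
      have h1 := Complex.norm_mul_exp_arg_mul_I d
      rwa [hd, Complex.ofReal_one, one_mul] at h1
    rwa [hd'] at h
  have hc : Continuous (R.toFun 1 ∘ K) := (R.toDiffeomorph 1).continuous.comp hK
  refine ⟨R.toFun 1 ∘ K, ?_, fun t => hpage _ (hKp t), hc, shadow_comp_ambientIsotopy R 1 hK hc⟩
  have h := hKe.diffeomorph_comp (R.toDiffeomorph 1)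
  rwa [AmbientIsotopy.coe_toDiffeomorph] at h

/-- **N3a on any page from N3a on the page of direction `1`.** [cite: Baykur2006, proof of Thm. 5.1] -/
theorem stcurve_of_page_one (g : ℕ)
    (h1 : ∀ v : Fin g ⊕ Fin g → ℤ, IsPrimitive v →
      ∃ K : Metric.sphere (0 : EuclideanSpace ℝ (Fin 2)) 1 → Base g,
        Manifold.IsSmoothEmbedding (𝓡 1) (𝓡∂ 4) ∞ K ∧ (∀ θ, K θ ∈ page g 1) ∧
        ∃ hK : Continuous K, shadow g K hK = v)
    {d : ℂ} (hd : ‖d‖ = 1) (v : Fin g ⊕ Fin g → ℤ) (hv : IsPrimitive v) :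
    ∃ K : Metric.sphere (0 : EuclideanSpace ℝ (Fin 2)) 1 → Base g,
      Manifold.IsSmoothEmbedding (𝓡 1) (𝓡∂ 4) ∞ K ∧ (∀ θ, K θ ∈ page g d) ∧
      ∃ hK : Continuous K, shadow g K hK = v := by
  obtain ⟨K, hKe, hKp, hK, hKs⟩ := h1 v hv
  obtain ⟨K', hK'e, hK'p, hK', hK's⟩ := exists_embedded_pageCurve_rotate g hd K hKe hKp hK
  exact ⟨K', hK'e, hK'p, hK', hK's.trans hKs⟩

/-! ## The registered form -/

/-- **Sub-goal `helper_STcurve_of_page_one`** (G6-4, node N3a `node_STcurve` on any page from the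
page of direction `1`): if every primitive class is the shadow of a smoothly embedded curve of
`page g 1`, then of `page g d` for every unit `d`. [cite: Baykur2006, proof of Thm. 5.1] -/
theorem helper_STcurve_of_page_one : ∀ (g : ℕ), (∀ v : Fin g ⊕ Fin g → ℤ, Literature.GroupTheory.CombinatorialGroupTheory.SignedHurwitz.IsPrimitive v → ∃ K : Metric.sphere (0 : EuclideanSpace ℝ (Fin 2)) 1 → Literature.Topology.FourManifolds.LefschetzBase.Base g, Manifold.IsSmoothEmbedding (𝓡 1) (𝓡∂ 4) ∞ K ∧ (∀ θ, K θ ∈ Literature.Topology.FourManifolds.LefschetzBase.page g 1) ∧ ∃ hK : Continuous K, Literature.Topology.FourManifolds.LefschetzBase.shadow g K hK = v) → ∀ (d : ℂ), ‖d‖ = 1 → ∀ (v : Fin g ⊕ Fin g → ℤ), Literature.GroupTheory.CombinatorialGroupTheory.SignedHurwitz.IsPrimitive v → ∃ K : Metric.sphere (0 : EuclideanSpace ℝ (Fin 2)) 1 → Literature.Topology.FourManifolds.LefschetzBase.Base g, Manifold.IsSmoothEmbedding (𝓡 1) (𝓡∂ 4) ∞ K ∧ (∀ θ, K θ ∈ Literature.Topology.FourManifolds.LefschetzBase.page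 g d) ∧ ∃ hK : Continuous K, Literature.Topology.FourManifolds.LefschetzBase.shadow g K hK = v :=
  fun g h1 _ hd v hv => stcurve_of_page_one g h1 hd v hv

end Summit.SmoothPoincare4.SmoothPoincare4.Theorems.AcyclicBisectionExists.ModpBraidOrbits

end
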